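import Literature.IUT.LogVolume.LegendreTorsionFieldUnramified
import Literature.IUT.LogVolume.ThetaFieldReading
import Literature.NumberTheory.EllipticCurves.KummerUnramifiedConverse
import HarnessLib

/-!
# [IUTchIV] Thm. 1.10 (D0), `F`-layer, for every field PINNED by the v3 Θ-datum (`Cor22.IsSubThetaField`):
# `F/F_tpd` is unramified at the good places `v ∤ 2·3·5` of `λ`

Mochizuki, *Inter-universal Teichmüller theory IV*, RIMS manuscript (Apr. 2020; = PRIMS **57** (2021)), Thm.
1.10 p. 22 ("`F` is obtained from `F_tpd` by adjoining `√−1`, together with the fields of definition of the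
`(3·5)`-torsion points of a model `E_{F_tpd}` … determined by the Legendre form") and proof Step (iii) (D0)
p. 26. The cell's model reading v3 (`ThetaFieldReading.lean`, abc-iut-S2 / w4-d037 / plan 2026-08-26T02:33Z) pins
the field of a genuine Θ-volume datum by `Cor22.IsSubThetaField P F`: `F` is generated over `F_tpd` by square roots
of `−1`, `λ`, `λ − 1` and coordinates of `F`-rational `15`-torsion points of the Legendre curve `E_λ`
(`F_tpd ⊆ F ⊆ F‡(P) = F_tpd(√−1, √λ, √(λ−1), E_λ[3·5])`; print's `F_E` qualifies). THIS FILE proves the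
unramifiedness half of Prop. 1.8 (vi)/(vii)/(D0) for EVERY such `F` that is Galois over `F_tpd` (the datum's `F`
is: [IUTchI] Rmk. 3.1.5): at a good place `v ∤ 2·3·5` of `λ` one has `|λ|_v = |λ−1|_v = 1`
(`valuation_legendre_eq_one_of_valuation_jInv_le_one`), so the absolute inertia group at `v` fixes the square
roots of the `v`-units `−1, λ, λ−1` (Lang, *FDG* Ch. 6 Prop. 1.3; tree
`absoluteGaloisGroup_inertia_fixes_root_of_not_mem`) and the `15`-torsion of the good-reduction Legendre
equation (Silverman VII.4.1), hence an isomorphic copy of `F` in `F̄_tpd`: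

* `smul_eq_of_mem_inertia_of_pow_eq_algebraMap` — absolute inertia at `v` fixes every `d`-th root (`d ∉ v`) of a
  `v`-UNIT `a ∈ F_tpd` (not necessarily integral: `a = b/c` with `b, c ∈ 𝓞 ∖ v`);
* `ramificationIdx_eq_one_of_adjoin_mixedGenerators` — the three-way general form (roots of unity / radicals of
  `v`-units / prime-to-`v` torsion coordinates of `E_λ`) of `ramificationIdx_eq_one_of_adjoin_legendreTorsion`;
* `ramificationIdx_subThetaField_eq_one` — **`e(w|v) = 1` for every pinned `F` (`IsSubThetaField P F`, Galois over
  `F_tpd`) at every place `w` over a good place `v ∤ 2·3·5` of `λ`** (the hypothesis `hFgood` of abc-iut-L5-t15's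
  `Cor22.ndeg_differentDivisor_add_logCondOver_le` for the v3 datum's field).

Theorems only (one private factorisation lemma adapted from the tree's `KummerGeneratorsUnramified`);
classical; TAKES NO SIDE on [IUTchIII] Cor. 3.12.
-/

noncomputable section

open scoped Classical

namespace Literature.IUT.LogVolume

namespace Cor22

open NumberField IsDedekindDomain Literature.NumberTheory.DiophantineGeometry.GenEll
open Literature.NumberTheory.EllipticCurves Literature.NumberTheory.GaloisRepresentations
open Literature.NumberTheory.NumberFields WeierstrassCurve IntermediateField Field

/-! ## Absolute inertia fixes radicals of `v`-units -/

section Radicals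

variable {K : Type} [Field K] [NumberField K]

/-- A `v`-unit `a ∈ K` (`ord_v a = 0`) is `b/c` with `b, c ∈ 𝓞 K ∖ v` (adapted verbatim from the tree's private
lemma in `KummerGeneratorsUnramified.lean`: `(m) = v^k·Q`, pick `c ∈ Q ∖ v`). [folklore] -/
private theorem exists_mul_eq_of_valuation_eq_one' (v : HeightOneSpectrum (𝓞 K)) {a : K}
    (ha : v.valuation K a = 1) :
    ∃ c b : 𝓞 K, c ∉ v.asIdeal ∧ b ∉ v.asIdeal ∧ (c : K) * a = b := by
  classical
  obtain ⟨n, m, hm, rfl⟩ := IsFractionRing.div_surjective (A := 𝓞 K) a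
  have hm0 : m ≠ 0 := nonZeroDivisors.ne_zero hm
  have hmK : (m : K) ≠ 0 := by
    simpa using (RingOfIntegers.coe_ne_zero_iff (x := m)).mpr hm0
  haveI := v.isMaximal
  -- `(m) = v^k * Q` with `v ⊔ Q = ⊤`
  have hI : Ideal.span {m} ≠ ⊥ := by simpa [Ideal.span_singleton_eq_bot] using hm0
  obtain ⟨Q, hvQ, hfac⟩ := Ideal.eq_prime_pow_mul_coprime hI v.asIdeal
  set k := Multiset.count v.asIdeal (UniqueFactorizationMonoid.normalizedFactors (Ideal.span {m}))
    with hk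
  -- pick `c ∈ Q ∖ v`
  have hQv : ¬ Q ≤ v.asIdeal := by
    intro hle
    have : v.asIdeal ⊔ Q ≤ v.asIdeal := sup_le le_rfl hle
    rw [hvQ] at this
    exact v.isMaximal.ne_top (top_le_iff.mp this)
  obtain ⟨c, hcQ, hcv⟩ := SetLike.not_le_iff_exists.mp hQv
  -- `n ∈ v^k` since `ord_v n = ord_v m`
  have hmvk : m ∈ v.asIdeal ^ k := by
    have : m ∈ Ideal.span {m} := Ideal.mem_span_singleton_self m
    rw [hfac] at this
    exact Ideal.mul_le_right this
  have hval_nm : v.intValuation n = v.intValuation m := by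
    have h := ha
    rw [map_div₀, HeightOneSpectrum.valuation_of_algebraMap,
      HeightOneSpectrum.valuation_of_algebraMap] at h
    have hm' : v.intValuation m ≠ 0 := v.intValuation_ne_zero _ hm0
    rwa [div_eq_one_iff_eq hm'] at h
  have hnvk : n ∈ v.asIdeal ^ k := by
    rw [← HeightOneSpectrum.intValuation_le_pow_iff_mem, hval_nm,
      HeightOneSpectrum.intValuation_le_pow_iff_mem]
    exact hmvk
  -- hence `c * n ∈ (m)`
  have hcn : c * n ∈ Ideal.span {m} := by
    rw [hfac, mul_comm (v.asIdeal ^ k) Q]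
    exact Ideal.mul_mem_mul hcQ hnvk
  obtain ⟨b, hb⟩ := Ideal.mem_span_singleton'.mp hcn
  refine ⟨c, b, hcv, ?_, ?_⟩
  · -- `b ∉ v`: `ord_v b = ord_v c + ord_v n - ord_v m = 0`
    intro hbv
    have h1 : v.intValuation (c * n) < 1 := by
      rw [← hb, map_mul]
      calc v.intValuation b * v.intValuation m
          < 1 * v.intValuation m := by
            refine mul_lt_mul_of_pos_right ((v.intValuation_lt_one_iff_mem b).mpr hbv) ?_
            exact zero_lt_iff.mpr (v.intValuation_ne_zero _ hm0)
        _ ≤ 1 * 1 := by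
            exact mul_le_mul_of_nonneg_left (v.intValuation_le_one m) zero_le_one
        _ = 1 := one_mul 1
    have h2 : v.intValuation (c * n) = v.intValuation m := by
      rw [map_mul, hval_nm, (v.intValuation_lt_one_iff_mem c).not.mpr hcv |> not_lt.mp |>
        le_antisymm (v.intValuation_le_one c), one_mul]
    rw [h2] at h1
    have h3 := (v.intValuation_lt_one_iff_mem m).mp h1
    -- then `ord_v m > 0`, so `ord_v n > 0`, so both in `v`; but then `c n = b m` — fine, derive the
    -- contradiction from valuations: `ord_v(c n) = ord_v n = ord_v m` while `ord_v(b m) > ord_v m`.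
    have h4 : v.intValuation (b * m) < v.intValuation m := by
      rw [map_mul]
      calc v.intValuation b * v.intValuation m
          < 1 * v.intValuation m := by
            refine mul_lt_mul_of_pos_right ((v.intValuation_lt_one_iff_mem b).mpr hbv) ?_
            exact zero_lt_iff.mpr (v.intValuation_ne_zero _ hm0)
        _ = v.intValuation m := one_mul _
    rw [hb, h2] at h4
    exact lt_irrefl _ h4
  · rw [mul_div_assoc', div_eq_iff hmK]
    have : ((c * n : 𝓞 K) : K) = ((b * m : 𝓞 K) : K) := by rw [hb]
    simpa using this

/-- **Absolute inertia at `v` fixes the `d`-th roots of `v`-units of `K`** (`d ∉ v`; Lang, *FDG* Ch. 6 Prop.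
1.3, "if" direction, unit case — the tree's `absoluteGaloisGroup_inertia_fixes_root_of_not_mem` for integral
radicands, extended to `a = b/c` with `b, c ∈ 𝓞 K ∖ v`: `c·α` is a `d`-th root of the integral `v`-unit
`c^{d-1}·b`). [cite: Lang1983, Ch. 6 Prop. 1.3] -/
theorem smul_eq_of_mem_inertia_of_pow_eq_algebraMap (v : HeightOneSpectrum (𝓞 K)) {d : ℕ}
    (hd : (d : 𝓞 K) ∉ v.asIdeal) {a : K} (ha : v.valuation K a = 1) {α : AlgebraicClosure K}
    (hα : α ^ d = algebraMap K (AlgebraicClosure K) a)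
    {𝔓 : Ideal (absIntegers (𝓞 K) K)} (h𝔓 : 𝔓 ∈ v.primesAbove)
    {σ : absoluteGaloisGroup K} (hσ : σ ∈ 𝔓.inertia (absoluteGaloisGroup K)) : σ • α = α := by
  have hd0 : d ≠ 0 := by
    rintro rfl
    exact hd (by simp)
  obtain ⟨c, b, hcv, hbv, hcab⟩ := exists_mul_eq_of_valuation_eq_one' v ha
  set a' : 𝓞 K := c ^ (d - 1) * b with ha'
  have hc0 : algebraMap K (AlgebraicClosure K) (c : K) ≠ 0 := by
    rw [map_ne_zero]
    intro h
    exact hcv (by rw [(RingOfIntegers.coe_eq_zero_iff).mp h]; exact zero_mem _)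
  have hα' : (algebraMap K (AlgebraicClosure K) (c : K) * α) ^ d =
      algebraMap (𝓞 K) (AlgebraicClosure K) a' := by
    rw [mul_pow, hα, ← map_pow, ← map_mul, ha']
    change _ = algebraMap K (AlgebraicClosure K) ((c ^ (d - 1) * b : 𝓞 K) : K)
    congr 1
    have : (c : K) ^ d * a = (c : K) ^ (d - 1) * ((c : K) * a) := by
      rw [← mul_assoc, ← pow_succ, Nat.sub_add_cancel (Nat.pos_of_ne_zero hd0)]
    rw [this, hcab]
    push_cast
    ring
  have ha'v : a' ∉ v.asIdeal := by
    haveI := v.isPrime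
    intro h
    rcases v.isPrime.mem_or_mem h with h | h
    · exact hcv (v.isPrime.mem_of_pow_mem _ h)
    · exact hbv h
  have hfix := absoluteGaloisGroup_inertia_fixes_root_of_not_mem v ha'v hd hα' h𝔓 hσ
  -- `σ • (c α) = c α` and `σ • c = c`
  have hσc : σ • algebraMap K (AlgebraicClosure K) (c : K) = algebraMap K (AlgebraicClosure K) (c : K) :=
    AlgEquiv.commutes (absoluteGaloisGroup.toAlgEquiv K σ) _
  rw [smul_mul', hσc] at hfix
  exact mul_left_cancel₀ hc0 hfix

end Radicals

/-! ## The three-way general unramifiedness lemma over the Legendre curve -/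

variable {P : NFPoint} (F : Type) [Field F] [NumberField F] [Algebra P.F F]

/-- **A finite Galois extension of `F_tpd` generated by (i) roots of unity of order prime to `v`, (ii) radicals
`α^d = a` of `v`-units `a ∈ F_tpd` with `d ∉ v`, and (iii) coordinates of prime-to-`v` torsion points of the
Legendre curve, is unramified at every good place `v ∤ 2` of `λ`.** [cite: Mochizuki2012, IUTchIV Thm 1.10 proof Step (iii) (D0) p.26]
[cite: SilvermanAEC2009, Prop. VII.4.1(a)] [cite: Lang1983, Ch. 6 Prop. 1.3] -/
theorem ramificationIdx_eq_one_of_adjoin_mixedGenerators (hU : P.InU) [IsGalois P.F F] {S : Set F}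
    (hgen : IntermediateField.adjoin P.F S = ⊤) (w : HeightOneSpectrum (𝓞 F))
    (hS : ∀ x ∈ S,
      (∃ m : ℕ, ((m : ℕ) : 𝓞 P.F) ∉ (finBelow P.F F w).asIdeal ∧ x ^ m = 1) ∨
      (∃ (d : ℕ) (a : P.F), ((d : ℕ) : 𝓞 P.F) ∉ (finBelow P.F F w).asIdeal ∧
        (finBelow P.F F w).valuation P.F a = 1 ∧ x ^ d = algebraMap P.F F a) ∨
      ∃ (n : ℕ) (T : (P.legendreCurve.baseChange F).toAffine.Point),
        ((n : ℕ) : 𝓞 P.F) ∉ (finBelow P.F F w).asIdeal ∧ (n : ℤ) • T = 0 ∧ x ∈ pointCoords T)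
    (h2 : ((2 : ℕ) : 𝓞 P.F) ∉ (finBelow P.F F w).asIdeal) (hgood : finBelow P.F F w ∉ badPlaces P) :
    w.asIdeal.ramificationIdx (𝓞 P.F) = 1 := by
  haveI : P.legendreCurve.IsElliptic := P.legendreCurve_isElliptic_iff.2 hU
  set v := finBelow P.F F w with hvdef
  have hgoodred : P.legendreCurve.HasGoodReductionAt v := legendreCurve_hasGoodReductionAt hU v h2 hgood
  -- `F ≃ F_tpd(φ S) ⊆ F̄_tpd`
  haveI : FiniteDimensional P.F F := Module.Finite.of_restrictScalars_finite ℚ P.F F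
  set Ω := AlgebraicClosure P.F
  let φ : F →ₐ[P.F] Ω := IsAlgClosed.lift
  set L : IntermediateField P.F Ω := IntermediateField.adjoin P.F (φ '' S) with hLdef
  have hL : φ.fieldRange = L := by
    rw [AlgHom.fieldRange_eq_map, ← hgen, IntermediateField.adjoin_map]
  let e : F ≃ₐ[P.F] L :=
    (((IntermediateField.topEquiv (F := P.F) (E := F)).symm.trans (IntermediateField.equivMap ⊤ φ)).trans
      (IntermediateField.equivOfEq (AlgHom.fieldRange_eq_map φ).symm)).trans
      (IntermediateField.equivOfEq hL)
  haveI : FiniteDimensional P.F L := LinearEquiv.finiteDimensional e.toLinearEquiv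
  haveI : IsGalois P.F L := IsGalois.of_algEquiv e
  haveI : NumberField L := NumberField.of_module_finite P.F L
  -- the inertia group at `v` fixes `φ S`
  obtain ⟨𝔓, h𝔓⟩ := HeightOneSpectrum.primesAbove_nonempty v
  have hfixS : ∀ σ ∈ 𝔓.inertia (absoluteGaloisGroup P.F), ∀ s ∈ φ '' S, σ • s = s := by
    intro σ hσ s hs
    obtain ⟨x, hx, rfl⟩ := hs
    rcases hS x hx with ⟨m, hm, hxm⟩ | ⟨d, a, hd, ha, hxd⟩ | ⟨n, T, hn, hT, hxT⟩
    · -- (i) a root of unity of order prime to `v`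
      have hxm' : (φ x) ^ m = 1 := by rw [← map_pow, hxm, map_one]
      exact smul_eq_of_mem_inertia_of_pow_eq_one v h𝔓 hσ hm hxm'
    · -- (ii) a radical of a `v`-unit
      have hxd' : (φ x) ^ d = algebraMap P.F Ω a := by rw [← map_pow, hxd, φ.commutes]
      exact smul_eq_of_mem_inertia_of_pow_eq_algebraMap v hd ha hxd' h𝔓 hσ
    · -- (iii) a coordinate of an `n`-torsion point: transport `T` to `E(F̄_tpd)` along `φ`
      let T' : geomPoints P.legendreCurve := Affine.Point.map (W' := P.legendreCurve.toAffine) φ T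
      have hT' : (n : ℤ) • T' = 0 := by
        change (n : ℤ) • Affine.Point.map (W' := P.legendreCurve.toAffine) φ T = 0
        rw [← map_zsmul, hT, map_zero]
      have hmem : T' ∈ geomTorsion P.legendreCurve (n : ℤ) := by
        change T' ∈ AddSubgroup.torsionBy (geomPoints P.legendreCurve) _
        rw [AddSubgroup.torsionBy, Submodule.mem_toAddSubgroup, Submodule.mem_torsionBy_iff]
        exact hT'
      have hfix : σ • T' = T' := by
        have := P.legendreCurve.smul_geomTorsion_eq_of_mem_inertia hgoodred (n := (n : ℤ))
          (by exact_mod_cast hn) h𝔓 hσ ⟨T', hmem⟩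
        exact congrArg Subtype.val this
      refine forall_coords_of_smul_eq P σ T' hfix (φ x) ?_
      rcases T with _ | ⟨a, b, hab⟩
      · simp [pointCoords] at hxT
      · change φ x ∈ pointCoords (Affine.Point.map (W' := P.legendreCurve.toAffine) φ
          (Affine.Point.some a b hab))
        rw [Affine.Point.map_some]
        simp only [pointCoords, Set.mem_insert_iff, Set.mem_singleton_iff] at hxT ⊢
        rcases hxT with rfl | rfl
        · exact Or.inl rfl
        · exact Or.inr rfl
  -- hence every prime of `𝓞 L` over `v` is unramified, in particular the one corresponding to `w`
  set Q : Ideal (𝓞 L) := w.asIdeal.map (RingOfIntegers.mapAlgEquiv e : 𝓞 F ≃ₐ[𝓞 P.F] 𝓞 L) with hQ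
  haveI : Q.IsPrime := isPrime_map_mapAlgEquiv e w
  haveI : Q.LiesOver v.asIdeal := liesOver_map_mapAlgEquiv e w _
  rw [← ramificationIdx_map_mapAlgEquiv e w]
  exact ramificationIdx_adjoin_eq_one_of_forall_smul_eq v (φ '' S) h𝔓 hfixS Q

/-! ## The field pinned by the v3 Θ-datum -/

/-- **At a good place `v ∤ 2` of `λ`, `λ` and `λ − 1` are `v`-units** (`|λ|_v = |λ−1|_v = 1`, Silverman
VII.5.4 (c) for the Legendre equation). [cite: SilvermanAEC2009, proof of Prop. VII.5.4(c) (PDF p. 176)] -/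
theorem valuation_x_eq_one_and_of_not_mem_badPlaces (hU : P.InU) (v : HeightOneSpectrum (𝓞 P.F))
    (h2 : ((2 : ℕ) : 𝓞 P.F) ∉ v.asIdeal) (hv : v ∉ badPlaces P) :
    v.valuation P.F P.x = 1 ∧ v.valuation P.F (P.x - 1) = 1 := by
  have hj : v.valuation P.F (jInv P.x) ≤ 1 := by
    by_contra h
    apply hv
    unfold badPlaces
    rw [Set.Finite.mem_toFinset]
    exact not_le.mp h
  have hw2 : v.valuation P.F (2 : P.F) = 1 := by
    apply le_antisymm
    · have h : v.valuation P.F (algebraMap (𝓞 P.F) P.F ((2 : ℕ) : 𝓞 P.F)) ≤ 1 :=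
        v.valuation_le_one _
      rwa [map_natCast, Nat.cast_ofNat] at h
    · have h' : ¬ v.valuation P.F (algebraMap (𝓞 P.F) P.F ((2 : ℕ) : 𝓞 P.F)) < 1 := by
        rw [HeightOneSpectrum.valuation_lt_one_iff_mem]; exact h2
      rw [map_natCast, Nat.cast_ofNat] at h'
      exact not_lt.mp h'
  exact valuation_legendre_eq_one_of_valuation_jInv_le_one (v.valuation P.F) hw2 hU.1 hU.2 hj

/-- **(D0), `F`-layer, for every field pinned by the v3 Θ-datum**: if `IsSubThetaField P F` (`F` generated over
`F_tpd` by square roots of `−1, λ, λ−1` and `15`-torsion coordinates of `E_λ`) and `F/F_tpd` is Galois, then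
`e(w|v) = 1` at every place `w` of `F` over a good place `v ∤ 2·3·5` of `λ` (square roots: radicals of the
`v`-units `−1, λ, λ−1` with `2 ∉ v`; torsion coordinates: `15 ∉ v`, good reduction of the Legendre equation).
This is the hypothesis `hFgood` of `Cor22.ndeg_differentDivisor_add_logCondOver_le` for the datum's field.
[cite: Mochizuki2012, IUTchIV Thm 1.10 proof Step (iii) (D0) p.26] -/
theorem ramificationIdx_subThetaField_eq_one (hU : P.InU) (hF : IsSubThetaField P F) [IsGalois P.F F]
    (w : HeightOneSpectrum (𝓞 F)) (h30 : ((30 : ℕ) : 𝓞 P.F) ∉ (finBelow P.F F w).asIdeal)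
    (hgood : finBelow P.F F w ∉ badPlaces P) : w.asIdeal.ramificationIdx (𝓞 P.F) = 1 := by
  set v := finBelow P.F F w with hvdef
  have hnat : ∀ {m : ℕ}, m ∣ 30 → ((m : ℕ) : 𝓞 P.F) ∉ v.asIdeal := by
    intro m hm h
    apply h30
    obtain ⟨c, hc⟩ := hm
    rw [hc, Nat.cast_mul]
    exact v.asIdeal.mul_mem_right _ h
  have h2 : ((2 : ℕ) : 𝓞 P.F) ∉ v.asIdeal := hnat ⟨15, by norm_num⟩
  have h15 : ((15 : ℕ) : 𝓞 P.F) ∉ v.asIdeal := hnat ⟨2, by norm_num⟩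
  obtain ⟨hx, hx1⟩ := valuation_x_eq_one_and_of_not_mem_badPlaces hU v h2 hgood
  have hneg1 : v.valuation P.F (-1 : P.F) = 1 := by rw [Valuation.map_neg, map_one]
  refine ramificationIdx_eq_one_of_adjoin_mixedGenerators F hU hF.adjoin_eq_top w (fun x hx' => ?_) h2 hgood
  rcases hx' with (hsq | hsq | hsq) | htor
  · -- `x² = −1`
    refine Or.inr (Or.inl ⟨2, -1, h2, hneg1, ?_⟩)
    rw [hsq, map_neg, map_one]
  · -- `x² = λ`
    exact Or.inr (Or.inl ⟨2, P.x, h2, hx, hsq⟩)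
  · -- `x² = λ − 1`
    refine Or.inr (Or.inl ⟨2, P.x - 1, h2, hx1, ?_⟩)
    rw [hsq, map_sub, map_one]
  · -- a `15`-torsion coordinate
    rw [torsionCoords_eq] at htor
    obtain ⟨T, hT, hxT⟩ := Set.mem_iUnion₂.1 htor
    exact Or.inr (Or.inr ⟨15, T, h15, hT, hxT⟩)

end Cor22

end Literature.IUT.LogVolume

end
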